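import Mathlib
import Summits.Ventures.HodgeRepro.Tier4.Common.AdelicDefs
import Summits.Ventures.HodgeRepro.Tier4.Common.CongruenceAdeles
import Summits.Ventures.HodgeRepro.Tier4.Common.CompactOpenLevel
import Summits.Ventures.HodgeRepro.Tier4.Common.RowWeights
import Summits.Ventures.HodgeRepro.Tier4.Line1.AdelicParts
import Summits.Ventures.HodgeRepro.Tier4.Line1.FiniteLevelIsolation
import Summits.Ventures.HodgeRepro.Tier4.Line4.LevelCosetCongruence
import Summits.Ventures.HodgeRepro.Tier4.Line4.IntegerArchBound
import Summits.Ventures.HodgeRepro.Tier4.Line4.L1ClassV3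
import Summits.Ventures.HodgeRepro.Tier4.Line4.ArchDistBounds
import Summits.Ventures.HodgeRepro.Tier4.Line4.ArchDistLower
import Summits.Ventures.HodgeRepro.Tier4.Line4.BlockDetCongruence
import Summits.Ventures.HodgeRepro.Tier4.Line4.FinitePartCongruence
import Summits.Ventures.HodgeRepro.Tier4.Line4.OrbitInvariant

/-!
# Tier4/Line4/OrbitInvariantFinite — the orbit invariant on FINITE PARTS: congruence, size, and the OFF-FIBRE
sparsity read-out (C-L4-ORBINV part 2 / SparsityOffFibre, lead (R-27)(a) + (R-29)(b))

Blind re-derivation cell `pub-hodge-repro`, Tier 4 «prove the step» (README §9–§10), seat t4-L1-p3 (gen 4).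
Tree path `lean/Summits/Ventures/HodgeRepro/Tier4/Line4/OrbitInvariantFinite.lean`.

SHAPE OF RECORD ((R-29)(b), v0.34 `TailFamily'.suppFin`): the support representative `x` (adelic; `x = t⁻¹ γ t'` with
`γ` rational and `t, t'` in the adelic tori) satisfies `GA.ofFinPart W x = κ₁ * GA.ofFinPart W γ₀ * κ₂` with
`κ₁, κ₂ ∈ K(N)` — a statement about FINITE PARTS.  Then:
* `finPart_orbitInv_eq_of_finPart_mat_eq` — `finPart (orbitInv W g x)` depends only on the finite parts of the
  entries of `x`; hence `finPart (orbitInv (ofFinPart x)) = finPart (orbitInv x)`;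
* `finPart_orbitInv_sub_mem_modSet_of_ofFinPart_eq` — the CONGRUENCE on finite parts:
  `finPart (orbitInv x) − finPart (orbitInv γ₀) ∈ N · ∏_v 𝓞_v` (OrbitInvariant (4) on `κ₁ (ofFinPart γ₀) κ₂`);
* `exists_eq_N_mul_of_orbitInv_eq_algebraMap` — when `orbitInv x` is PRINCIPAL (`x = t⁻¹ γ t'`, `γ` rational:
  `orbitInv_orbit`), `orbitInv x − orbitInv γ₀` is `N` times an integer of `k` (FinitePartCongruence (A));
* `norm_adToC_orbitInv_le` — the SIZE: `‖adToC w (orbitInv W g x)‖ ≤ 2 (G · archSizeAt W w x)²`, `G` bounding the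
  entries of the transport `g` at `w` (the invariant is quadratic in the entries);
* **`log_max_one_le_two_mul_archDist_add_of_orbitInv_ne`** — THE OFF-FIBRE READ-OUT: for `x` in the level-`N`
  support coset with `orbitInv x` principal and `orbitInv x ≠ orbitInv γ₀` (off the fibre of the invariant),
  `log (max 1 (N − B)) ≤ 2 · archDist W x + log (2 G²)` — x2's `hR` binder with `d := archDist W`,
  `g N := (log (max 1 (N − B)) − log (2 G²)) / 2` (`hR_of_sparsity`, SparsityScale);
* `log_max_one_le_two_mul_archDist_add_of_orbitInv_ne_seesaw` — the same on the seesaw shape with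
  `x = τ * γ * τ'`, `τ ∈ torusT`, `τ' ∈ torusT'`, `γ` rational (principality by `orbitInv_orbit`).

JUNK TEST: `hcos` with `x = γ₀`, `κ₁ = κ₂ = 1` is satisfiable, and `hne` is then false — the statements are not
vacuous; `hne` is the genuine off-fibre hypothesis (LevelKVacuity explains why the ADELIC `κ γ₀ κ'` form was not).
No printed input.  HC_CM is NOT proved by anyone in this repository.
-/

namespace Summit.Ventures.HodgeRepro.Tier4.Line4

open Summit.Ventures.HodgeRepro.Tier4.Common Summit.Ventures.HodgeRepro.Tier4.Line1 NumberField Matrix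
open scoped NumberField

noncomputable section

section Finite

variable {k : Type} [Field k] [NumberField k] (W : PlaneData k) (g : Matrix (Fin 4) (Fin 4) k)

/-- `finPart` of the invariant depends only on the finite parts of the entries. -/
theorem finPart_orbitInv_eq_of_finPart_mat_eq {x y : GA W}
    (h : ∀ i j, finPart k (GA.mat W x i j) = finPart k (GA.mat W y i j)) :
    finPart k (orbitInv W g x) = finPart k (orbitInv W g y) := by
  simp only [orbitInv_eq_blockDet, blockDet, map_sub, map_mul, Matrix.mul_apply, map_sum, h]

/-- `finPart (orbitInv (ofFinPart x)) = finPart (orbitInv x)`. -/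
theorem finPart_orbitInv_ofFinPart (x : GA W) :
    finPart k (orbitInv W g (GA.ofFinPart W x)) = finPart k (orbitInv W g x) :=
  finPart_orbitInv_eq_of_finPart_mat_eq W g fun i j => finPart_mat_ofFinPart_apply W x i j

/-- **THE CONGRUENCE ON FINITE PARTS**: if the finite part of `x` lies in `K(N) γ₀ K(N)` (`γ₀` finite-integral, `g`
finite-integral) then `finPart (orbitInv x) − finPart (orbitInv γ₀) ∈ N · ∏_v 𝓞_v`. -/
theorem finPart_orbitInv_sub_mem_modSet_of_ofFinPart_eq {N : ℕ} (hg : IsIntegralFinMat (adMat k g))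
    {κ₁ κ₂ x γ₀ : GA W} (hκ₁ : κ₁ ∈ levelK W N) (hκ₂ : κ₂ ∈ levelK W N) (hint : IsIntegralFin W γ₀)
    (hcos : GA.ofFinPart W x = κ₁ * GA.ofFinPart W γ₀ * κ₂) :
    finPart k (orbitInv W g x) - finPart k (orbitInv W g γ₀) ∈ modSet k N := by
  have hc := (orbitInv_sub_mem_congrSet_of_mem_levelK W g hg hκ₁ hκ₂ (IsIntegralFin.ofFinPart W hint)).2
  rw [map_sub, ← hcos, finPart_orbitInv_ofFinPart, finPart_orbitInv_ofFinPart] at hc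
  exact hc

/-- **THE RATIONAL FORM**: if moreover `orbitInv x` is principal (`= algebraMap c`) and `γ₀` is rational with
`k`-matrix `m₀`, then `c − orbitInvK g m₀` is `N` times an integer of `k`. -/
theorem exists_eq_N_mul_of_orbitInv_eq_algebraMap {N : ℕ} (hN : N ≠ 0) (hg : IsIntegralFinMat (adMat k g))
    {κ₁ κ₂ x γ₀ : GA W} (hκ₁ : κ₁ ∈ levelK W N) (hκ₂ : κ₂ ∈ levelK W N) (hint : IsIntegralFin W γ₀)
    (hcos : GA.ofFinPart W x = κ₁ * GA.ofFinPart W γ₀ * κ₂) {c : k}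
    (hx : orbitInv W g x = algebraMap k (Ad k) c) {m₀ : Matrix (Fin 4) (Fin 4) k}
    (hm₀ : GA.mat W γ₀ = m₀.map (algebraMap k (Ad k))) :
    ∃ z : 𝓞 k, c - orbitInvK g m₀ = (N : k) * algebraMap (𝓞 k) k z := by
  have h := finPart_orbitInv_sub_mem_modSet_of_ofFinPart_eq W g hg hκ₁ hκ₂ hint hcos
  rw [hx, orbitInv_eq_algebraMap W g hm₀, ← map_sub, ← map_sub] at h
  exact exists_eq_N_mul_of_finPart_algebraMap_mem_modSet hN h

end Finite

section Size

variable {k : Type} [Field k] [NumberField k] (W : PlaneData k) (g : Matrix (Fin 4) (Fin 4) k)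

/-- An entry of `x g` read at `w` is at most `archSizeAt W w x` times a bound `G` on the entries of `g` at `w`. -/
theorem norm_adToC_mul_adMat_le (w : InfinitePlace k) {G : ℝ}
    (hG : ∀ l j : Fin 4, ‖Common.adToC w (adMat k g l j)‖ ≤ G) (x : GA W) (i j : Fin 4) :
    ‖Common.adToC w ((GA.mat W x * adMat k g) i j)‖ ≤ L1Class.archSizeAt W w x * G := by
  have hG0 : 0 ≤ G := le_trans (norm_nonneg _) (hG 0 0)
  rw [Matrix.mul_apply, map_sum]
  calc ‖∑ l : Fin 4, Common.adToC w (GA.mat W x i l * adMat k g l j)‖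
      ≤ ∑ l : Fin 4, ‖Common.adToC w (GA.mat W x i l * adMat k g l j)‖ := norm_sum_le _ _
    _ = ∑ l : Fin 4, ‖Common.adToC w (GA.mat W x i l)‖ * ‖Common.adToC w (adMat k g l j)‖ := by
        simp only [map_mul, norm_mul]
    _ ≤ ∑ l : Fin 4, ‖Common.adToC w (GA.mat W x i l)‖ * G :=
        Finset.sum_le_sum fun l _ => mul_le_mul_of_nonneg_left (hG l j) (norm_nonneg _)
    _ = (∑ l : Fin 4, ‖Common.adToC w (GA.mat W x i l)‖) * G := by rw [Finset.sum_mul]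
    _ ≤ L1Class.archSizeAt W w x * G := by
        refine mul_le_mul_of_nonneg_right ?_ hG0
        unfold L1Class.archSizeAt
        exact Finset.single_le_sum (f := fun i' => ∑ l : Fin 4, ‖Common.adToC w (GA.mat W x i' l)‖)
          (fun _ _ => Finset.sum_nonneg fun _ _ => norm_nonneg _) (Finset.mem_univ i)

/-- **THE SIZE OF THE INVARIANT**: `‖adToC w (orbitInv W g x)‖ ≤ 2 (G · archSizeAt W w x)²`. -/
theorem norm_adToC_orbitInv_le (w : InfinitePlace k) {G : ℝ}
    (hG : ∀ l j : Fin 4, ‖Common.adToC w (adMat k g l j)‖ ≤ G) (x : GA W) :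
    ‖Common.adToC w (orbitInv W g x)‖ ≤ 2 * (L1Class.archSizeAt W w x * G) ^ 2 := by
  have hb := norm_adToC_mul_adMat_le W g w hG x
  have h0 : 0 ≤ L1Class.archSizeAt W w x * G :=
    le_trans (norm_nonneg _) (hb 0 0)
  rw [orbitInv_eq_blockDet, blockDet, map_sub, map_mul, map_mul]
  calc ‖Common.adToC w ((GA.mat W x * adMat k g) 0 0) * Common.adToC w ((GA.mat W x * adMat k g) 1 1) -
        Common.adToC w ((GA.mat W x * adMat k g) 0 1) * Common.adToC w ((GA.mat W x * adMat k g) 1 0)‖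
      ≤ ‖Common.adToC w ((GA.mat W x * adMat k g) 0 0)‖ * ‖Common.adToC w ((GA.mat W x * adMat k g) 1 1)‖ +
        ‖Common.adToC w ((GA.mat W x * adMat k g) 0 1)‖ * ‖Common.adToC w ((GA.mat W x * adMat k g) 1 0)‖ := by
        refine (norm_sub_le _ _).trans ?_
        rw [norm_mul, norm_mul]
    _ ≤ (L1Class.archSizeAt W w x * G) * (L1Class.archSizeAt W w x * G) +
        (L1Class.archSizeAt W w x * G) * (L1Class.archSizeAt W w x * G) := by
        gcongr
        · exact hb 0 0
        · exact hb 1 1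
        · exact hb 0 1
        · exact hb 1 0
    _ = 2 * (L1Class.archSizeAt W w x * G) ^ 2 := by ring

/-- `log (max 1 (a y)) ≤ log a + log (max 1 y)` for `a ≥ 1`. -/
theorem log_max_one_mul_le_of_one_le {a y : ℝ} (ha : 1 ≤ a) :
    Real.log (max 1 (a * y)) ≤ Real.log a + Real.log (max 1 y) := by
  have h1 : (1 : ℝ) ≤ max 1 y := le_max_left _ _
  have hle : max 1 (a * y) ≤ a * max 1 y := by
    refine max_le ?_ ?_
    · exact one_le_mul_of_one_le_of_one_le ha h1
    · exact mul_le_mul_of_nonneg_left (le_max_right _ _) (le_trans zero_le_one ha)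
  rw [← Real.log_mul (by positivity) (by positivity)]
  exact Real.log_le_log (lt_of_lt_of_le zero_lt_one (le_max_left _ _)) hle

/-- `log (max 1 (y ^ 2)) = 2 log (max 1 y)` for `y ≥ 0`. -/
theorem log_max_one_sq (y : ℝ) (hy : 0 ≤ y) : Real.log (max 1 (y ^ 2)) = 2 * Real.log (max 1 y) := by
  have h : max 1 (y ^ 2) = (max 1 y) ^ 2 := by
    rcases le_or_gt y 1 with h1 | h1
    · rw [max_eq_left (by nlinarith), max_eq_left h1, one_pow]
    · rw [max_eq_right (by nlinarith), max_eq_right h1.le]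
  rw [h, Real.log_pow]
  push_cast
  ring

/-- A lower bound on the size of the invariant reads into `archDist`: `r ≤ ‖adToC w (orbitInv W g x)‖` gives
`log (max 1 r) ≤ 2 · archDist W x + log (2 G²)` for `G ≥ 1` bounding the entries of `g` at `w`. -/
theorem log_max_one_le_two_mul_archDist_add_of_le_norm_orbitInv (w : InfinitePlace k) {G : ℝ} (hG1 : 1 ≤ G)
    (hG : ∀ l j : Fin 4, ‖Common.adToC w (adMat k g l j)‖ ≤ G) (x : GA W) {r : ℝ}
    (hr : r ≤ ‖Common.adToC w (orbitInv W g x)‖) :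
    Real.log (max 1 r) ≤ 2 * L1Class.archDist W x + Real.log (2 * G ^ 2) := by
  have hX : 0 ≤ L1Class.archSizeAt W w x := L1Class.archSizeAt_nonneg W w x
  have hsize := norm_adToC_orbitInv_le W g w hG x
  have h2G : (1 : ℝ) ≤ 2 * G ^ 2 := by nlinarith
  have hr' : r ≤ 2 * G ^ 2 * L1Class.archSizeAt W w x ^ 2 := by
    calc r ≤ ‖Common.adToC w (orbitInv W g x)‖ := hr
      _ ≤ 2 * (L1Class.archSizeAt W w x * G) ^ 2 := hsize
      _ = 2 * G ^ 2 * L1Class.archSizeAt W w x ^ 2 := by ring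
  calc Real.log (max 1 r)
      ≤ Real.log (max 1 (2 * G ^ 2 * L1Class.archSizeAt W w x ^ 2)) :=
        Real.log_le_log (lt_of_lt_of_le zero_lt_one (le_max_left _ _)) (max_le_max le_rfl hr')
    _ ≤ Real.log (2 * G ^ 2) + Real.log (max 1 (L1Class.archSizeAt W w x ^ 2)) :=
        log_max_one_mul_le_of_one_le h2G
    _ = Real.log (2 * G ^ 2) + 2 * Real.log (max 1 (L1Class.archSizeAt W w x)) := by
        rw [log_max_one_sq _ hX]
    _ ≤ Real.log (2 * G ^ 2) + 2 * L1Class.archDist W x := by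
        have := L1Class.log_max_one_archSizeAt_le_archDist W w x
        linarith
    _ = 2 * L1Class.archDist W x + Real.log (2 * G ^ 2) := by ring

/-- **THE OFF-FIBRE SPARSITY READ-OUT (SparsityOffFibre)**: for `x` in the level-`N` support coset of a rational
finite-integral `γ₀` (finite-part form), with `orbitInv x` principal and `≠ orbitInv γ₀`, and `B` bounding
`‖adToC w (orbitInv γ₀)‖` at every place, `G ≥ 1` bounding the entries of `g` at every place:
`log (max 1 (N − B)) ≤ 2 · archDist W x + log (2 G²)`. -/
theorem log_max_one_le_two_mul_archDist_add_of_orbitInv_ne {N : ℕ} (hN : N ≠ 0)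
    (hg : IsIntegralFinMat (adMat k g)) {G : ℝ} (hG1 : 1 ≤ G)
    (hG : ∀ (w : InfinitePlace k) (l j : Fin 4), ‖Common.adToC w (adMat k g l j)‖ ≤ G)
    {κ₁ κ₂ x γ₀ : GA W} (hκ₁ : κ₁ ∈ levelK W N) (hκ₂ : κ₂ ∈ levelK W N)
    (hγ₀ : γ₀ ∈ rationalPoints W) (hint : IsIntegralFin W γ₀)
    (hcos : GA.ofFinPart W x = κ₁ * GA.ofFinPart W γ₀ * κ₂) {c : k}
    (hx : orbitInv W g x = algebraMap k (Ad k) c) (hne : orbitInv W g x ≠ orbitInv W g γ₀)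
    {B : ℝ} (hB : ∀ w : InfinitePlace k, ‖Common.adToC w (orbitInv W g γ₀)‖ ≤ B) :
    Real.log (max 1 ((N : ℝ) - B)) ≤ 2 * L1Class.archDist W x + Real.log (2 * G ^ 2) := by
  obtain ⟨m₀, hm₀⟩ := exists_rational_mat_of_mem_rationalPoints W hγ₀
  obtain ⟨z, hz⟩ := exists_eq_N_mul_of_orbitInv_eq_algebraMap W g hN hg hκ₁ hκ₂ hint hcos hx hm₀
  have hz0 : z ≠ 0 := by
    intro h0
    apply hne
    rw [h0, map_zero, mul_zero, sub_eq_zero] at hz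
    rw [hx, orbitInv_eq_algebraMap W g hm₀, hz]
  obtain ⟨w, hw⟩ := exists_infinitePlace_natCast_le_of_sub_eq hz0 hz
  have h1 := L1Class.InfinitePlace.apply_sub_le w c (orbitInvK g m₀)
  have h2 : w (orbitInvK g m₀) = ‖Common.adToC w (orbitInv W g γ₀)‖ := by
    rw [orbitInv_eq_algebraMap W g hm₀, L1Class.norm_adToC_algebraMap]
  have h3 : w c = ‖Common.adToC w (orbitInv W g x)‖ := by
    rw [hx, L1Class.norm_adToC_algebraMap]
  have hB' := hB w
  refine log_max_one_le_two_mul_archDist_add_of_le_norm_orbitInv W g w hG1 (hG w) x ?_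
  linarith

/-- A bound `G ≥ 1` on the entries of the transport `g` at every infinite place exists (a constant of the data). -/
theorem exists_bound_entries_adMat :
    ∃ G : ℝ, 1 ≤ G ∧ ∀ (w : InfinitePlace k) (l j : Fin 4), ‖Common.adToC w (adMat k g l j)‖ ≤ G := by
  refine ⟨max 1 (∑ w : InfinitePlace k, ∑ l : Fin 4, ∑ j : Fin 4, ‖Common.adToC w (adMat k g l j)‖),
    le_max_left _ _, fun w l j => ?_⟩
  refine le_trans ?_ (le_max_right _ _)
  calc ‖Common.adToC w (adMat k g l j)‖
      ≤ ∑ j' : Fin 4, ‖Common.adToC w (adMat k g l j')‖ :=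
        Finset.single_le_sum (f := fun j' => ‖Common.adToC w (adMat k g l j')‖)
          (fun _ _ => norm_nonneg _) (Finset.mem_univ j)
    _ ≤ ∑ l' : Fin 4, ∑ j' : Fin 4, ‖Common.adToC w (adMat k g l' j')‖ :=
        Finset.single_le_sum (f := fun l' => ∑ j' : Fin 4, ‖Common.adToC w (adMat k g l' j')‖)
          (fun _ _ => Finset.sum_nonneg fun _ _ => norm_nonneg _) (Finset.mem_univ l)
    _ ≤ ∑ w' : InfinitePlace k, ∑ l' : Fin 4, ∑ j' : Fin 4, ‖Common.adToC w' (adMat k g l' j')‖ :=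
        Finset.single_le_sum (f := fun w' => ∑ l' : Fin 4, ∑ j' : Fin 4, ‖Common.adToC w' (adMat k g l' j')‖)
          (fun _ _ => Finset.sum_nonneg fun _ _ => Finset.sum_nonneg fun _ _ => norm_nonneg _)
          (Finset.mem_univ w)

/-- A bound on the invariant of `γ₀` at every infinite place exists (a constant of `γ₀`). -/
theorem exists_bound_orbitInv (γ₀ : GA W) :
    ∃ B : ℝ, ∀ w : InfinitePlace k, ‖Common.adToC w (orbitInv W g γ₀)‖ ≤ B := by
  refine ⟨∑ w : InfinitePlace k, ‖Common.adToC w (orbitInv W g γ₀)‖, fun w => ?_⟩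
  exact Finset.single_le_sum (f := fun w' => ‖Common.adToC w' (orbitInv W g γ₀)‖)
    (fun _ _ => norm_nonneg _) (Finset.mem_univ w)

end Size

section Seesaw

variable {k : Type} [Field k] [NumberField k] (q : QuadData k) (a b ε a' b' ε' : k)
  (g g' : Matrix (Fin 4) (Fin 4) k) (hgg' : g * g' = 1) (hg'g : g' * g = 1)
  (hgΩ : g * (PlaneData.ofLinesRow q a b ε).Ω = (PlaneData.ofLinesRow q a b ε).Ω * g)

/-- **SparsityOffFibre on the seesaw shape**: `x = τ γ τ'` with `τ ∈ T(𝔸)`, `τ' ∈ T′(𝔸)`, `γ` rational — the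
invariant of `x` is that of `γ` (principal), and the off-fibre read-out follows. -/
theorem log_max_one_le_two_mul_archDist_add_of_orbitInv_ne_seesaw (ha : a ≠ 0) (hb : b ≠ 0) (hε : ε ≠ 0)
    (ha' : a' ≠ 0) (hb' : b' ≠ 0) (hε' : ε' ≠ 0) (lam : k)
    (hiso : g * (PlaneData.ofLinesRow q a' b' ε').B * gᵀ = lam • (PlaneData.ofLinesRow q a b ε).B)
    {N : ℕ} (hN : N ≠ 0) (hg : IsIntegralFinMat (adMat k g)) {G : ℝ} (hG1 : 1 ≤ G)
    (hG : ∀ (w : InfinitePlace k) (l j : Fin 4), ‖Common.adToC w (adMat k g l j)‖ ≤ G)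
    {κ₁ κ₂ τ γ τ' γ₀ : GA ((PlaneData.ofLinesRow q a b ε).withTransportedTorus g g' hgg' hg'g hgΩ)}
    (hκ₁ : κ₁ ∈ levelK _ N) (hκ₂ : κ₂ ∈ levelK _ N)
    (hτ : τ ∈ torusT ((PlaneData.ofLinesRow q a b ε).withTransportedTorus g g' hgg' hg'g hgΩ))
    (hτ' : τ' ∈ torusT' ((PlaneData.ofLinesRow q a b ε).withTransportedTorus g g' hgg' hg'g hgΩ))
    (hγ : γ ∈ rationalPoints _) (hγ₀ : γ₀ ∈ rationalPoints _) (hint : IsIntegralFin _ γ₀)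
    (hcos : GA.ofFinPart _ (τ * γ * τ') = κ₁ * GA.ofFinPart _ γ₀ * κ₂)
    (hne : orbitInv _ g (τ * γ * τ') ≠ orbitInv _ g γ₀)
    {B : ℝ} (hB : ∀ w : InfinitePlace k, ‖Common.adToC w (orbitInv _ g γ₀)‖ ≤ B) :
    Real.log (max 1 ((N : ℝ) - B)) ≤ 2 * L1Class.archDist _ (τ * γ * τ') + Real.log (2 * G ^ 2) := by
  obtain ⟨m, hm⟩ := exists_rational_mat_of_mem_rationalPoints _ hγ
  have hx : orbitInv _ g (τ * γ * τ') = algebraMap k (Ad k) (orbitInvK g m) := by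
    rw [orbitInv_orbit q a b ε a' b' ε' g g' hgg' hg'g hgΩ ha hb hε ha' hb' hε' lam hiso τ γ τ' hτ hτ',
      orbitInv_eq_algebraMap _ g hm]
  exact log_max_one_le_two_mul_archDist_add_of_orbitInv_ne _ g hN hg hG1 hG hκ₁ hκ₂ hγ₀ hint hcos hx hne hB

end Seesaw

/-! ## v2 (append): the read-out at ANY point with the same invariant — in particular at the RATIONAL point `γ` itself
(x2's `hR` binder of `exists_fibreDominated_of_level_decay_count` is `g N ≤ d γ` with `d : S.Gk → ℝ`, LevelTail). -/

section Transfer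

variable {k : Type} [Field k] [NumberField k] (W : PlaneData k) (g : Matrix (Fin 4) (Fin 4) k)

/-- **THE OFF-FIBRE READ-OUT AT ANY POINT WITH THE SAME INVARIANT**: the congruence is read on `x` (finite part in the
level coset), the size on `y` with `orbitInv y = orbitInv x` — e.g. `y = γ` rational for `x = τ γ τ'`. -/
theorem log_max_one_le_two_mul_archDist_add_of_orbitInv_ne' {N : ℕ} (hN : N ≠ 0)
    (hg : IsIntegralFinMat (adMat k g)) {G : ℝ} (hG1 : 1 ≤ G)
    (hG : ∀ (w : InfinitePlace k) (l j : Fin 4), ‖Common.adToC w (adMat k g l j)‖ ≤ G)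
    {κ₁ κ₂ x y γ₀ : GA W} (hκ₁ : κ₁ ∈ levelK W N) (hκ₂ : κ₂ ∈ levelK W N)
    (hγ₀ : γ₀ ∈ rationalPoints W) (hint : IsIntegralFin W γ₀)
    (hcos : GA.ofFinPart W x = κ₁ * GA.ofFinPart W γ₀ * κ₂) (hxy : orbitInv W g x = orbitInv W g y) {c : k}
    (hy : orbitInv W g y = algebraMap k (Ad k) c) (hne : orbitInv W g y ≠ orbitInv W g γ₀)
    {B : ℝ} (hB : ∀ w : InfinitePlace k, ‖Common.adToC w (orbitInv W g γ₀)‖ ≤ B) :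
    Real.log (max 1 ((N : ℝ) - B)) ≤ 2 * L1Class.archDist W y + Real.log (2 * G ^ 2) := by
  obtain ⟨m₀, hm₀⟩ := exists_rational_mat_of_mem_rationalPoints W hγ₀
  have hx : orbitInv W g x = algebraMap k (Ad k) c := hxy.trans hy
  obtain ⟨z, hz⟩ := exists_eq_N_mul_of_orbitInv_eq_algebraMap W g hN hg hκ₁ hκ₂ hint hcos hx hm₀
  have hz0 : z ≠ 0 := by
    intro h0
    apply hne
    rw [h0, map_zero, mul_zero, sub_eq_zero] at hz
    rw [hy, orbitInv_eq_algebraMap W g hm₀, hz]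
  obtain ⟨w, hw⟩ := exists_infinitePlace_natCast_le_of_sub_eq hz0 hz
  have h1 := L1Class.InfinitePlace.apply_sub_le w c (orbitInvK g m₀)
  have h2 : w (orbitInvK g m₀) = ‖Common.adToC w (orbitInv W g γ₀)‖ := by
    rw [orbitInv_eq_algebraMap W g hm₀, L1Class.norm_adToC_algebraMap]
  have h3 : w c = ‖Common.adToC w (orbitInv W g y)‖ := by
    rw [hy, L1Class.norm_adToC_algebraMap]
  have hB' := hB w
  refine log_max_one_le_two_mul_archDist_add_of_le_norm_orbitInv W g w hG1 (hG w) y ?_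
  linarith

end Transfer

section SeesawRational

variable {k : Type} [Field k] [NumberField k] (q : QuadData k) (a b ε a' b' ε' : k)
  (g g' : Matrix (Fin 4) (Fin 4) k) (hgg' : g * g' = 1) (hg'g : g' * g = 1)
  (hgΩ : g * (PlaneData.ofLinesRow q a b ε).Ω = (PlaneData.ofLinesRow q a b ε).Ω * g)

/-- **SparsityOffFibre AT THE RATIONAL POINT** (x2's `hR` shape, `d γ := archDist W γ`): for rational `γ` with a
torus translate `τ γ τ'` (`τ ∈ T(𝔸)`, `τ' ∈ T′(𝔸)`) whose finite part lies in the level-`N` coset of `γ₀`, off the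
fibre of `γ₀`: `log (max 1 (N − B)) ≤ 2 · archDist W γ + log (2 G²)`. -/
theorem log_max_one_le_two_mul_archDist_add_of_orbitInv_ne_seesaw' (ha : a ≠ 0) (hb : b ≠ 0) (hε : ε ≠ 0)
    (ha' : a' ≠ 0) (hb' : b' ≠ 0) (hε' : ε' ≠ 0) (lam : k)
    (hiso : g * (PlaneData.ofLinesRow q a' b' ε').B * gᵀ = lam • (PlaneData.ofLinesRow q a b ε).B)
    {N : ℕ} (hN : N ≠ 0) (hg : IsIntegralFinMat (adMat k g)) {G : ℝ} (hG1 : 1 ≤ G)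
    (hG : ∀ (w : InfinitePlace k) (l j : Fin 4), ‖Common.adToC w (adMat k g l j)‖ ≤ G)
    {κ₁ κ₂ τ γ τ' γ₀ : GA ((PlaneData.ofLinesRow q a b ε).withTransportedTorus g g' hgg' hg'g hgΩ)}
    (hκ₁ : κ₁ ∈ levelK _ N) (hκ₂ : κ₂ ∈ levelK _ N)
    (hτ : τ ∈ torusT ((PlaneData.ofLinesRow q a b ε).withTransportedTorus g g' hgg' hg'g hgΩ))
    (hτ' : τ' ∈ torusT' ((PlaneData.ofLinesRow q a b ε).withTransportedTorus g g' hgg' hg'g hgΩ))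
    (hγ : γ ∈ rationalPoints _) (hγ₀ : γ₀ ∈ rationalPoints _) (hint : IsIntegralFin _ γ₀)
    (hcos : GA.ofFinPart _ (τ * γ * τ') = κ₁ * GA.ofFinPart _ γ₀ * κ₂)
    (hne : orbitInv _ g γ ≠ orbitInv _ g γ₀)
    {B : ℝ} (hB : ∀ w : InfinitePlace k, ‖Common.adToC w (orbitInv _ g γ₀)‖ ≤ B) :
    Real.log (max 1 ((N : ℝ) - B)) ≤ 2 * L1Class.archDist _ γ + Real.log (2 * G ^ 2) := by
  obtain ⟨m, hm⟩ := exists_rational_mat_of_mem_rationalPoints _ hγ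
  have hxy : orbitInv _ g (τ * γ * τ') = orbitInv _ g γ :=
    orbitInv_orbit q a b ε a' b' ε' g g' hgg' hg'g hgΩ ha hb hε ha' hb' hε' lam hiso τ γ τ' hτ hτ'
  exact log_max_one_le_two_mul_archDist_add_of_orbitInv_ne' _ g hN hg hG1 hG hκ₁ hκ₂ hγ₀ hint hcos hxy
    (orbitInv_eq_algebraMap _ g hm) hne hB

end SeesawRational

end

end Summit.Ventures.HodgeRepro.Tier4.Line4
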